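import Literature.Geometry.Kaehler.ComplexTorusCyclotomicCharpolyFifteen
import Literature.Geometry.Kaehler.ComplexTorusCyclotomicAutomorphismOrderSixteenHodge
import HarnessLib

/-!
# The Hodge side of the complex tori with an endomorphism of characteristic polynomial `Φ₁₅`: the primitive CM types of
# `ℚ(ζ₁₅)` have rank `5` (nondegenerate), the imprimitive ones rank `3` and `2`; `rank MT = 5 / 3 / 2`; the Hodge classes on
# every power of every such torus are divisor classes; the Hodge conjecture for all powers of the simple ζ₁₅-fourfolds

Layer `Literature/Geometry/Kaehler`, namespace `Literature.Geometry.Kaehler.ComplexTorus`; sequel of this seat's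
`CyclotomicCMTypeCensusFifteen` (the sixteen CM types of `ℚ(ζ₁₅)` in four families, residue sets `{1,2,4,7}` (primitive),
`{1,2,7,11}` (stable under `11`: induced from `ℚ(ζ₅)`), `{1,2,4,8}` (under `2`: from `ℚ(√−15)`), `{1,4,7,13}` (under `7`: from
`ℚ(√−3)`)), `ComplexTorusCyclotomicCharpolyFifteen` (EXACTLY FOUR complex tori with `P_u = Φ₁₅`, one simple, the others
`∼ B²`, `∼ E⁴`, `∼ E′⁴`) and `ComplexTorusCyclotomicAutomorphismOrderSixteenHodge` (the same programme for `ℚ(ζ₁₆)`, whose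
`cmTypeRank_eq_of_isAutTransform` is reused), lane `lit-hodgefound` (Track 2 foundations library), prover seat
`lit-hodgefound-p10`, generation 33, row «A2-26(gu)» (self-proposed 2026-08-28).  THEOREMS ONLY (no definition, no named
fact, no `sorry`; one `decide` on `ℤ/15` in §1).

THE SOURCES.  B. Dodson, *The structure of Galois groups of CM-fields*, Trans. AMS **283** (1984), §3.1.0 p. 11 (the rank
`t(Φ)` of the span of the Galois orbit of `Φ`; `n + 1` = nondegenerate) and §3.3.2 Theorem p. 16 («Let `A` be a simple
Abelian variety of CM-type `(K, Φ)`, with `dim A = 4`. Then `A` is degenerate if and only if `Gal(Kᶜ/ℚ) = ℤ₂ × A₄`, or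
`ℤ₂ × S₄` and `(K, Φ)` is the reflex of a type on a CM-field of degree `6`» — for the ABELIAN field `ℚ(ζ₁₅)` neither occurs:
the simple ζ₁₅-fourfold is nondegenerate; here by direct count); B. Dodson, J. Algebra **107** (1987), §1.1 p. 50
(`Rank(Φ) = dim MT`); B. Moonen, Yu. Zarhin, *Hodge classes on abelian varieties of low dimension*, Math. Ann. **315**
(1999), Thm. 0.1; B. B. Gordon, *A survey of the Hodge conjecture for abelian varieties* (1999), 5.13 and §9.3–9.4
(Hazama–Murty: nondegenerate ⟺ `Hdg = Div` on all powers); G. Shimura (1998), §6.2 Thm. 3, §8.2 Prop. 26, §8.4;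
Ch. Birkenhake, H. Lange (2004), §13.3.

## What is proved

* §1 (types of `K`, `[IsCyclotomicExtension {15} ℚ K]`): **`five_le_cmTypeRank_of_residueSet_eq_fifteen`** — for the type
  with residue set `{1,2,4,7}` the translates by the automorphisms of `ℂ` with cyclotomic characters `1, 2, 4, 7, 8`, read at
  the embeddings with exponents `2, 7, 11, 13, 14`, are linearly independent (an explicit `5 × 5` system over `ℚ`);
  `cmTypeRank_eq_five_of_residueSet_eq_fifteen`, **`cmTypeRank_eq_five_of_isPrimitive_fifteen`** (every primitive type of
  `ℚ(ζ₁₅)` has rank `5 = 4 + 1`), `isNondegenerate_of_isPrimitive_fifteen`, **`isNondegenerate_iff_isPrimitive_fifteen`**;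
  the imprimitive kinds: **`cmTypeRank_eq_three_of_stable_eleven_fifteen`** (types induced from `ℚ(ζ₅)`: rank `3`),
  **`cmTypeRank_eq_two_of_stable_two_or_seven_fifteen`** (types induced from `ℚ(√−15)`, `ℚ(√−3)`: rank `2`);
  `cmTypeRank_eq_five_iff_isPrimitive_fifteen`.
* §2 (abelian varieties of CM type `(ℚ(ζ₁₅); Φ)`, `Φ` primitive): **`isSimple_and_hodgeConjectureFor_pow_of_isPrimitive_fifteen`**
  — every realisation `A` is a SIMPLE abelian fourfold, `Bᵏ(Aⁿ) ⊗ ℂ = Dᵏ(Aⁿ) ⊗ ℂ` for all `n, k`, and the Hodge conjecture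
  holds for every power `Aⁿ`; `dim_eq_four_of_isCMTypeRealisation_fifteen`, `hodgeConjectureFor_of_isPrimitive_fifteen`;
  non-vacuity **`exists_isSimple_hodgeConjectureFor_pow_fifteen`**.
* §3 (complex tori `(X, u)`, `P_u = Φ₁₅`): **`IsSimple.mtRank_hodgeStructure_eq_five_of_charpoly_eq_cyclotomic_fifteen`**
  (`rank MT(X) = 5 = dim X + 1` for the simple one), **`mtRank_hodgeStructure_eq_of_not_isSimple_of_charpoly_eq_cyclotomic_fifteen`**
  (`rank MT(X) = 3` when `X ∼ B²`, `= 2` when `X ∼ E⁴`), `mtRank_hodgeStructure_eq_five_iff_isSimple_of_charpoly_eq_cyclotomic_fifteen`,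
  and **`divisorClasses_powPeriod_eq_hodgeClasses_of_charpoly_eq_cyclotomic_fifteen`**: `Hdg(Xᵏ) = Div(Xᵏ)` for ALL `k` and
  EVERY complex torus with an endomorphism of characteristic polynomial `Φ₁₅` (simple: rank `5`; non-simple: `B²`, `E⁴` with
  `B`, `E` simple of dimension `≤ 3`, transported along the isogeny).

## References

* [Dodson1984] B. Dodson, *The structure of Galois groups of CM-fields*, Trans. Amer. Math. Soc. 283 (1984) 1–32, §3.1.0
  p. 11, §3.3.2 Theorem p. 16 (held `paper:doi-10-2307-1999987`, read).
* [Dodson1987] B. Dodson, *On the Mumford–Tate group of an abelian variety with complex multiplication*, J. Algebra 107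
  (1987), §1.1 p. 50.
* [MoonenZarhin1999LowDim] B. Moonen, Yu. Zarhin, *Hodge classes on abelian varieties of low dimension*, Math. Ann. 315
  (1999), Thm. 0.1.
* [Gordon1999HodgeAVSurvey] B. B. Gordon, *A survey of the Hodge conjecture for abelian varieties*, Appendix B in
  J. Lewis, *A Survey of the Hodge Conjecture*, 2nd ed. (1999), 5.13, Thm. 6.4, §9.3, §9.4.
* [Kubota1965] T. Kubota, *On the field extension by complex multiplication*, Trans. AMS 118 (1965), §2 p. 115.
* [Shimura1998] G. Shimura, *Abelian Varieties with Complex Multiplication and Modular Functions*, Princeton (1998),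
  §6.1 Thm. 2, §6.2 Thm. 3, §8.2 Prop. 26, §8.4 Examples (1)–(2).
* [BirkenhakeLange2004] Ch. Birkenhake, H. Lange, *Complex Abelian Varieties*, 2nd ed. (2004), §13.3.
* [Deligne1982HodgeCycles] P. Deligne, *Hodge cycles on abelian varieties*, LNM 900 (1982), I §3, §5.
-/

noncomputable section

open scoped Classical nonZeroDivisors NumberField Manifold ContDiff MatrixGroups
open NumberField Module Polynomial CategoryTheory CategoryTheory.Limits

namespace Literature.Geometry.Kaehler

namespace ComplexTorus

-- `open scoped`: the tree's action of `Aut(ℂ)` on `Hom(K, ℂ)` by composition (`ringEquivCompAction`) is a scoped instance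
open scoped Literature.NumberTheory.ComplexMultiplication
open Literature.NumberTheory.Automorphic (IsTorusSubgroup)
open Literature.AlgebraicGeometry.Motives (CMType AbelianVariety HodgeTensorFacts hodgeTensorFacts_holds)
open Literature.AlgebraicGeometry.HodgeTheory (HodgeConjectureFor complexBetti)
open Literature.AlgebraicGeometry.VanGeemen1994 (hodgeClassSpan)
open Literature.Barriers.HodgeConjecture (divisorClassesSpan)
open Literature.NumberTheory.ComplexMultiplication (IsPrimitive translateInd translateInd_of_mem translateInd_of_not_mem
  inducedCMType exists_primitive_inducedCMType_eq_of_isCMField)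
open Literature.NumberTheory.ComplexMultiplication.CMTypeLattice (periodIso basisIndex card_basisIndex_eq_finrank
  isSimple_periodIso_iff_isPrimitive)
open Literature.AlgebraicGeometry.Pohlmann1968 (cmTypeRank cmTypeRank_le IsNondegenerate isNondegenerate_iff
  cmTypeRank_inducedCMType isNondegenerate_of_isPrimitive_of_finrank_le_six isNondegenerate_of_finrank_eq_two)
open Literature.AlgebraicGeometry.Pohlmann1968.Cyclotomic (autExp expOf exists_autExp_eq exists_expOf_eq)
open Literature.AlgebraicGeometry.ComplexMultiplication (IsCMTypeRealisation isPrimitive_ringEquiv_complex_iff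
  isSimple_of_isCMTypeRealisation_of_isPrimitive)
open Literature.AlgebraicGeometry.ComplexMultiplication.CMTorus (mtRank_hodgeStructure_periodIso_eq_cmTypeRank)
open Literature.AlgebraicGeometry.ComplexMultiplication.CyclotomicCMTypeResidueSets (IsAutTransform unitResidues residueSet
  expOf_smul expOf_mem_residueSet_iff IsAutTransform.isPrimitive_iff)
open Literature.AlgebraicGeometry.ComplexMultiplication.CyclotomicCMTypeCensusFifteen (exists_four_families_fifteen
  not_isPrimitive_iff_stable_fifteen)

/-! ### §1 The ranks of the CM types of `ℚ(ζ₁₅)`: `5` (primitive), `3` (from `ℚ(ζ₅)`), `2` (from `ℚ(√−15)`, `ℚ(√−3)`) -/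

section Types

variable {K : Type} [Field K] [NumberField K]

variable [IsCyclotomicExtension {15} ℚ K]

variable (K) in
/-- `ℚ(ζ₁₅)` is a CM field (Mathlib: `ℚ(ζₙ)`, `n > 2`). No instance is registered. [folklore] -/
private theorem isCMField_fifteen₃₆ : IsCMField K :=
  IsCyclotomicExtension.Rat.isCMField K (S := ({15} : Set ℕ)) ⟨15, rfl, by norm_num⟩

omit [IsCyclotomicExtension {15} ℚ K] in
/-- An embedding of `K` into `ℂ` exists. [folklore] -/
private theorem nonempty_embedding₃₆ : Nonempty (K →+* ℂ) := inferInstance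

/-- The indicator of a translate of `Φ`, read on exponents: `[τσ ∈ Φ] = [u(τ)·e(σ) ∈ S_Φ]`. [cite: Shimura1998, §8.4 Example (1)] -/
private theorem translateInd_eq_ite₃₆ (Φ : CMType K) (τ : ℂ ≃+* ℂ) (σ : K →+* ℂ) :
    translateInd Φ.1 τ σ = if autExp 15 τ * expOf 15 K σ ∈ residueSet 15 Φ then (1 : ℚ) else 0 := by
  have h : τ • σ ∈ Φ.1 ↔ autExp 15 τ * expOf 15 K σ ∈ residueSet 15 Φ := by
    rw [← expOf_mem_residueSet_iff 15 Φ, expOf_smul]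
  by_cases hm : autExp 15 τ * expOf 15 K σ ∈ residueSet 15 Φ
  · rw [translateInd_of_mem (h.2 hm), if_pos hm]
  · rw [translateInd_of_not_mem (fun h' => hm (h.1 h')), if_neg hm]

/-- **`Rank(Φ) ≥ 5` FOR THE TYPE `S_Φ = {1, 2, 4, 7}` OF `ℚ(ζ₁₅)`**: the translates of `Φ` by automorphisms of `ℂ` with
cyclotomic characters `1, 2, 4, 7, 8`, evaluated at the embeddings with exponents `2, 7, 11, 13, 14`, give the matrix
`(1,1,0,0,0; 1,0,1,0,0; 0,0,0,1,0; 0,1,1,1,0; 1,0,0,0,1)`, whose rows are linearly independent over `ℚ` (the system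
`g₁ + g₂ + g₅ = 0`, `g₁ + g₄ = g₂ + g₄ = g₃ + g₄ = 0`, `g₅ = 0` has only the zero solution), so five Galois translates of `Φ`
are linearly independent (Dodson's `t(Φ)`, computed on `(ℤ/15)ˣ`; no unitriangular `5 × 5` minor exists).
[cite: Dodson1984, §3.1.0 (p. 11)] [cite: Dodson1987, §1.1 (p. 50)] -/
theorem five_le_cmTypeRank_of_residueSet_eq_fifteen (Φ : CMType K) (hΦ : residueSet 15 Φ = {1, 2, 4, 7}) :
    5 ≤ cmTypeRank Φ := by
  classical
  have hu : ∀ i : Fin 5, ((![1, 2, 4, 7, 8] : Fin 5 → ZMod 15) i).val.Coprime 15 := by decide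
  have hc : ∀ j : Fin 5, ((![2, 7, 11, 13, 14] : Fin 5 → ZMod 15) j).val.Coprime 15 := by decide
  choose τ hτ using fun i : Fin 5 => exists_autExp_eq 15 _ (hu i)
  choose σ hσ using fun j : Fin 5 => exists_expOf_eq 15 K _ (hc j)
  let f : Fin 5 → (K →+* ℂ) → ℚ := fun i => translateInd Φ.1 (τ i)
  have hval : ∀ i j : Fin 5, f i (σ j) =
      if (![1, 2, 4, 7, 8] : Fin 5 → ZMod 15) i * (![2, 7, 11, 13, 14] : Fin 5 → ZMod 15) j ∈
        ({1, 2, 4, 7} : Finset (ZMod 15)) then (1 : ℚ) else 0 := by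
    intro i j
    show translateInd Φ.1 (τ i) (σ j) = _
    rw [translateInd_eq_ite₃₆, hτ, hσ, hΦ]
  have hli : LinearIndependent ℚ f := by
    rw [Fintype.linearIndependent_iff]
    intro g hg
    have heval : ∀ j : Fin 5, ∑ i, g i * f i (σ j) = 0 := fun j => by
      have := congrFun hg (σ j)
      simpa only [Finset.sum_apply, Pi.smul_apply, smul_eq_mul, Pi.zero_apply] using this
    have e0 := heval 0
    have e1 := heval 1
    have e2 := heval 2
    have e3 := heval 3
    have e4 := heval 4
    simp (config := { decide := true }) [Fin.sum_univ_five, hval] at e0 e1 e2 e3 e4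
    intro i
    fin_cases i <;> simp <;> linarith
  have h1 : Module.finrank ℚ (Submodule.span ℚ (Set.range f)) = 5 := by
    rw [finrank_span_eq_card hli, Fintype.card_fin]
  have h2 : Submodule.span ℚ (Set.range f) ≤
      Submodule.span ℚ (Set.range fun g : ℂ ≃+* ℂ => translateInd Φ.1 g) :=
    Submodule.span_mono (by rintro _ ⟨i, rfl⟩; exact ⟨τ i, rfl⟩)
  have h3 := Submodule.finrank_mono h2
  rw [h1] at h3
  exact h3

/-- **`Rank(Φ) = 5 = 4 + 1` for the type `{1, 2, 4, 7}`** (Kubota's bound `Rank ≤ n + 1`, `[ℚ(ζ₁₅) : ℚ] = 8`).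
[cite: Dodson1984, §3.1.0 (p. 11)] [cite: Kubota1965, §2 (p. 115)] -/
theorem cmTypeRank_eq_five_of_residueSet_eq_fifteen (Φ : CMType K) (hΦ : residueSet 15 Φ = {1, 2, 4, 7}) :
    cmTypeRank Φ = 5 := by
  haveI := isCMField_fifteen₃₆ K
  refine le_antisymm ?_ (five_le_cmTypeRank_of_residueSet_eq_fifteen Φ hΦ)
  have h := cmTypeRank_le Φ
  rw [finrank_eq_eight_of_isCyclotomicExtension_fifteen K inferInstance] at h
  exact h

omit [IsCyclotomicExtension {15} ℚ K] in
/-- **EVERY PRIMITIVE CM TYPE OF `ℚ(ζ₁₅)` HAS RANK `5`** — is NONDEGENERATE: the primitive types form one family (the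
census), the rank is constant on families, and the representative `{1,2,4,7}` has rank `5`.  Dodson's theorem for
simple CM fourfolds: degenerate only for `Gal(Kᶜ/ℚ) = ℤ₂ × A₄` or `ℤ₂ × S₄`, never for the abelian `ℚ(ζ₁₅)`; here by
direct count.
[cite: Dodson1984, §3.3.2 Theorem (p. 16)] [cite: Shimura1998, §8.4 Examples (1)–(2)] -/
theorem cmTypeRank_eq_five_of_isPrimitive_fifteen (hK : IsCyclotomicExtension {15} ℚ K) (Φ : CMType K) (φ₀ : K →+* ℂ)
    (hΦ : IsPrimitive (ℂ ≃+* ℂ) Φ.1 φ₀) : cmTypeRank Φ = 5 := by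
  obtain ⟨Φ₁, Φ₂, Φ₃, Φ₄, hr₁, -, -, -, -, hp₂, hp₃, hp₄, -, -, -, -, -, -, hall⟩ :=
    exists_four_families_fifteen (L := K) φ₀
  have h₁ : IsAutTransform Φ₁ Φ := by
    rcases hall Φ with h | h | h | h
    · exact h
    · exact absurd ((h.isPrimitive_iff 15 φ₀).1 hΦ) hp₂
    · exact absurd ((h.isPrimitive_iff 15 φ₀).1 hΦ) hp₃
    · exact absurd ((h.isPrimitive_iff 15 φ₀).1 hΦ) hp₄
  rw [cmTypeRank_eq_of_isAutTransform h₁]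
  exact cmTypeRank_eq_five_of_residueSet_eq_fifteen Φ₁ hr₁

omit [IsCyclotomicExtension {15} ℚ K] in
/-- **The primitive types of `ℚ(ζ₁₅)` are nondegenerate** (`Rank = [K:ℚ]/2 + 1`). [cite: Dodson1984, §3.3.2 Theorem (p. 16)]
[cite: Gordon1999HodgeAVSurvey, 5.13 (i)] -/
theorem isNondegenerate_of_isPrimitive_fifteen (hK : IsCyclotomicExtension {15} ℚ K) (Φ : CMType K) (φ₀ : K →+* ℂ)
    (hΦ : IsPrimitive (ℂ ≃+* ℂ) Φ.1 φ₀) : IsNondegenerate Φ := by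
  rw [isNondegenerate_iff, finrank_eq_eight_of_isCyclotomicExtension_fifteen K inferInstance]
  exact cmTypeRank_eq_five_of_isPrimitive_fifteen hK Φ φ₀ hΦ

omit [IsCyclotomicExtension {15} ℚ K] in
/-- **For `ℚ(ζ₁₅)`: NONDEGENERATE ⟺ PRIMITIVE** (⟸ above; ⟹ Kubota: a nondegenerate type is primitive).
[cite: Dodson1984, §3.3.2 Theorem (p. 16)] [cite: Kubota1965, §2 (p. 115)] -/
theorem isNondegenerate_iff_isPrimitive_fifteen (hK : IsCyclotomicExtension {15} ℚ K) (Φ : CMType K) (φ₀ : K →+* ℂ) :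
    IsNondegenerate Φ ↔ IsPrimitive (ℂ ≃+* ℂ) Φ.1 φ₀ := by
  haveI := isCMField_fifteen₃₆ K
  exact ⟨fun h ↦ h.isPrimitive φ₀, isNondegenerate_of_isPrimitive_fifteen hK Φ φ₀⟩

/-- **RANK `3` FOR THE `ℚ(ζ₅)`-TYPES**: a type of `ℚ(ζ₁₅)` whose residue set is stable under `11` is induced from a PRIMITIVE
type `Φ₁` of the quartic CM subfield `K₁` (`[K₁ : ℚ] = 4`, the field `ℚ(ζ₅) = ℚ(ζ₁₅³)`), `Rank(Φ) = Rank(Φ₁)` (Shimura's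
`r(ξ) = r(Inf ξ)`), and a primitive quartic type is nondegenerate: `Rank = 4/2 + 1 = 3`.
[cite: Shimura1998, §8.2 Prop. 26, §8.4 Example (2)] [cite: Dodson1987, §1.1 (p. 50)] [cite: Kubota1965, §2 (p. 115)] -/
theorem cmTypeRank_eq_three_of_stable_eleven_fifteen (Φ : CMType K)
    (h11 : ∀ c ∈ unitResidues 15, (c * 11 ∈ residueSet 15 Φ ↔ c ∈ residueSet 15 Φ)) : cmTypeRank Φ = 3 := by
  haveI := isCMField_fifteen₃₆ K
  obtain ⟨K₁, Φ₁, hCM, h₁, hp₁, -⟩ := exists_primitive_inducedCMType_eq_of_isCMField Φ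
  haveI := hCM
  obtain ⟨-, h4⟩ := finrank_eq_of_inducedCMType_eq_of_stable_eleven_fifteen h₁ hp₁ h11
  obtain ⟨s₀⟩ : Nonempty (K₁ →+* ℂ) := inferInstance
  have hnd := isNondegenerate_of_isPrimitive_of_finrank_le_six Φ₁ (by omega) s₀
    ((isPrimitive_ringEquiv_complex_iff Φ₁ s₀).2 hp₁)
  rw [← h₁, cmTypeRank_inducedCMType, (isNondegenerate_iff Φ₁).1 hnd, h4]

/-- **RANK `2` FOR THE `ℚ(√−15)`- AND `ℚ(√−3)`-TYPES**: a type of `ℚ(ζ₁₅)` whose residue set is stable under `2` or under `7`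
is induced from a type `Φ₁` of an imaginary quadratic subfield `K₁`, `Rank(Φ) = Rank(Φ₁) = 2/2 + 1 = 2` (CM elliptic
curves are nondegenerate). [cite: Shimura1998, §8.2 Prop. 26, §8.4 Example (2)] [cite: Dodson1987, §1.1 (p. 50)]
[cite: Kubota1965, §2 (p. 115)] -/
theorem cmTypeRank_eq_two_of_stable_two_or_seven_fifteen (Φ : CMType K)
    (h27 : (∀ c ∈ unitResidues 15, (c * 2 ∈ residueSet 15 Φ ↔ c ∈ residueSet 15 Φ)) ∨
      (∀ c ∈ unitResidues 15, (c * 7 ∈ residueSet 15 Φ ↔ c ∈ residueSet 15 Φ))) : cmTypeRank Φ = 2 := by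
  haveI := isCMField_fifteen₃₆ K
  obtain ⟨K₁, Φ₁, hCM, h₁, hp₁, -⟩ := exists_primitive_inducedCMType_eq_of_isCMField Φ
  haveI := hCM
  obtain ⟨-, h2⟩ := finrank_eq_of_inducedCMType_eq_of_stable_two_or_seven_fifteen h₁ hp₁ h27
  have hnd := isNondegenerate_of_finrank_eq_two Φ₁ h2
  rw [← h₁, cmTypeRank_inducedCMType, (isNondegenerate_iff Φ₁).1 hnd, h2]

omit [IsCyclotomicExtension {15} ℚ K] in
/-- **THE RANK TABLE OF `ℚ(ζ₁₅)`: `Rank(Φ) = 5 ⟺ Φ` primitive** (otherwise `3` or `2`). [cite: Dodson1984, §3.3.2 Theorem (p. 16)]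
[cite: Shimura1998, §8.4 Examples (1)–(2)] -/
theorem cmTypeRank_eq_five_iff_isPrimitive_fifteen (hK : IsCyclotomicExtension {15} ℚ K) (Φ : CMType K) (φ₀ : K →+* ℂ) :
    cmTypeRank Φ = 5 ↔ IsPrimitive (ℂ ≃+* ℂ) Φ.1 φ₀ := by
  refine ⟨fun h ↦ ?_, cmTypeRank_eq_five_of_isPrimitive_fifteen hK Φ φ₀⟩
  by_contra hnp
  rcases (not_isPrimitive_iff_stable_fifteen Φ φ₀).1 hnp with hB | hC | hD
  · rw [cmTypeRank_eq_three_of_stable_eleven_fifteen Φ hB] at h; omega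
  · rw [cmTypeRank_eq_two_of_stable_two_or_seven_fifteen Φ (Or.inl hC)] at h; omega
  · rw [cmTypeRank_eq_two_of_stable_two_or_seven_fifteen Φ (Or.inr hD)] at h; omega

/-- `rank MT(ℂ⁴/Φ(𝔞)) = Rank(Φ)` for the models of `ℚ(ζ₁₅)` (the tree's `mtRank_hodgeStructure_periodIso_eq_cmTypeRank`,
the CM instance supplied). [cite: Dodson1987, §1.1 (p. 50)] [cite: Deligne1982HodgeCycles, I Example 3.7] -/
private theorem mtRank_hodgeStructure_periodIso_eq_cmTypeRank_fifteen [HodgeTensorFacts.{0, 0}] (Φ : CMType K)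
    (I : (FractionalIdeal (𝓞 K)⁰ K)ˣ) : (hodgeStructure (periodIso Φ I) 1).mtRank = cmTypeRank Φ := by
  haveI := isCMField_fifteen₃₆ K
  exact mtRank_hodgeStructure_periodIso_eq_cmTypeRank Φ I

end Types

/-! ### §2 Abelian varieties of a primitive CM type of `ℚ(ζ₁₅)`: simple fourfolds satisfying the Hodge conjecture with all their powers -/

section Varieties

variable {K : Type} [Field K] [NumberField K] [IsCyclotomicExtension {15} ℚ K]
  {A : AbelianVariety ℂ} {ι : 𝓞 K →+* End A} {θ : K →+* Module.End ℂ (complexBetti A.X 1)}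

omit [IsCyclotomicExtension {15} ℚ K] in
/-- `dim A = 4` for a realisation of a CM type of `ℚ(ζ₁₅)` (`2 dim A = [K : ℚ] = 8`). [cite: Shimura1998, §6.2 Thm. 3] -/
theorem dim_eq_four_of_isCMTypeRealisation_fifteen (hK : IsCyclotomicExtension {15} ℚ K) {Φ : CMType K} (hA : IsCMTypeRealisation Φ A ι θ) :
    A.dim = 4 := by
  have h : A.dim = Module.finrank ℚ K / 2 := Literature.AlgebraicGeometry.Motives.schemeDim_eq_holds hA.1
  rw [h, finrank_eq_eight_of_isCyclotomicExtension_fifteen K inferInstance]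

omit [IsCyclotomicExtension {15} ℚ K] in
/-- **THE SIMPLE ζ₁₅-FOURFOLDS: SIMPLE, STABLY NONDEGENERATE, HODGE CONJECTURE ON ALL POWERS.**  Every abelian variety
`A` of a PRIMITIVE CM type `(ℚ(ζ₁₅); Φ)` is SIMPLE (Shimura §8.2 Prop. 26), has `Bᵏ(Aⁿ) ⊗ ℂ = Dᵏ(Aⁿ) ⊗ ℂ` for all `n, k`
(the type is nondegenerate, §1; White–Hazama–Murty, tree `IsNondegenerate.hodgeClassSpan_pow_eq_divisorClassesSpan`), and
satisfies, with all its powers, the Hodge conjecture, UNCONDITIONALLY. [cite: Dodson1984, §3.3.2 Theorem (p. 16)]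
[cite: Gordon1999HodgeAVSurvey, Thm. 6.4 and §9.3] [cite: Shimura1998, §8.2 Prop. 26] -/
theorem isSimple_and_hodgeConjectureFor_pow_of_isPrimitive_fifteen (hK : IsCyclotomicExtension {15} ℚ K) (Φ : CMType K)
    (φ₀ : K →+* ℂ) (hΦ : IsPrimitive (ℂ ≃+* ℂ) Φ.1 φ₀) (hA : IsCMTypeRealisation Φ A ι θ) (n k : ℕ) :
    A.IsSimple ∧
      hodgeClassSpan (⨁ fun _ : Fin n => A).dim (⨁ fun _ : Fin n => A).X k =
        divisorClassesSpan (⨁ fun _ : Fin n => A).X (⨁ fun _ : Fin n => A).dim k ∧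
      HodgeConjectureFor (⨁ fun _ : Fin n => A).dim (⨁ fun _ : Fin n => A).X := by
  haveI := isCMField_fifteen₃₆ K
  have hnd := isNondegenerate_of_isPrimitive_fifteen hK Φ φ₀ hΦ
  exact ⟨isSimple_of_isCMTypeRealisation_of_isPrimitive hA φ₀ hΦ, hnd.hodgeClassSpan_pow_eq_divisorClassesSpan hA n k,
    hnd.hodgeConjectureFor_pow hA n⟩

omit [IsCyclotomicExtension {15} ℚ K] in
/-- **The Hodge conjecture for every abelian variety of a primitive CM type of `ℚ(ζ₁₅)`** (`HodgeConjectureFor A.dim A.X`,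
`A.dim = 4`), UNCONDITIONAL. [cite: Dodson1984, §3.3.2 Theorem (p. 16)] [cite: Gordon1999HodgeAVSurvey, Thm. 6.4 and §9.3] -/
theorem hodgeConjectureFor_of_isPrimitive_fifteen (hK : IsCyclotomicExtension {15} ℚ K) (Φ : CMType K) (φ₀ : K →+* ℂ)
    (hΦ : IsPrimitive (ℂ ≃+* ℂ) Φ.1 φ₀) (hA : IsCMTypeRealisation Φ A ι θ) : HodgeConjectureFor A.dim A.X := by
  haveI := isCMField_fifteen₃₆ K
  exact (isNondegenerate_of_isPrimitive_fifteen hK Φ φ₀ hΦ).hodgeConjectureFor hA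

omit [IsCyclotomicExtension {15} ℚ K] in
variable (K) in
/-- **Non-vacuity (Shimura §6.2 Thm. 3, tree `exists_isCMTypeRealisation`)**: there IS a simple abelian FOURFOLD with
complex multiplication by `𝓞_{ℚ(ζ₁₅)}` of primitive type — carrying the automorphism `ζ₁₅` of order `15` — all of whose
powers satisfy the Hodge conjecture. [cite: Shimura1998, §6.2 Thm. 3, §8.4 Example (1)] [cite: Dodson1984, §3.3.2 Theorem (p. 16)] -/
theorem exists_isSimple_hodgeConjectureFor_pow_fifteen (hK : IsCyclotomicExtension {15} ℚ K) :
    ∃ (Φ : CMType K) (A : AbelianVariety ℂ) (ι' : 𝓞 K →+* End A) (θ' : K →+* Module.End ℂ (complexBetti A.X 1)),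
      IsCMTypeRealisation Φ A ι' θ' ∧ A.IsSimple ∧ A.dim = 4 ∧
        ∀ n : ℕ, HodgeConjectureFor (⨁ fun _ : Fin n => A).dim (⨁ fun _ : Fin n => A).X := by
  haveI := isCMField_fifteen₃₆ K
  obtain ⟨φ₀⟩ := nonempty_embedding₃₆ (K := K)
  obtain ⟨Φ₁, -, -, -, -, -, -, -, hp₁, -⟩ := exists_four_families_fifteen (L := K) φ₀
  obtain ⟨A, ι', θ', hA⟩ := Literature.AlgebraicGeometry.ComplexMultiplication.exists_isCMTypeRealisation Φ₁
  exact ⟨Φ₁, A, ι', θ', hA, (isSimple_and_hodgeConjectureFor_pow_of_isPrimitive_fifteen hK Φ₁ φ₀ hp₁ hA 0 0).1,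
    dim_eq_four_of_isCMTypeRealisation_fifteen hK hA,
    fun n ↦ (isSimple_and_hodgeConjectureFor_pow_of_isPrimitive_fifteen hK Φ₁ φ₀ hp₁ hA n 0).2.2⟩

end Varieties

/-! ### §3 The pairs `(X, u)`: rank of the Mumford–Tate group and `Hdg(Xᵏ) = Div(Xᵏ)` for every complex torus with an endomorphism of characteristic polynomial `Φ₁₅` -/

section Fifteen

variable {ι : Type} [Fintype ι] [DecidableEq ι] {E : Type} [NormedAddCommGroup E] [NormedSpace ℂ E]
  {P : (ι → ℝ) ≃L[ℝ] E}

omit [DecidableEq ι] [NormedSpace ℂ E] in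
/-- `rk Λ = 8 = φ(15)` when `P_u = Φ₁₅`. [cite: BirkenhakeLange2004, §13.3] -/
private theorem card_eq_eight₃₆ [DecidableEq ι] {A : Matrix ι ι ℤ} (hP : A.charpoly = cyclotomic 15 ℤ) :
    Fintype.card ι = 8 := by
  rw [card_eq_totient_of_charpoly_eq_cyclotomic hP]
  decide

set_option backward.isDefEq.respectTransparency false in -- Mathlib's instance
-- `IsCyclotomicExtension {15} ℚ (CyclotomicField 15 ℚ)` is keyed on `CyclotomicField.algebra`, the goal on
-- `DivisionRing.toRatAlgebra` (same workaround as `ComplexTorusCyclotomicCharpolyFifteen`)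
/-- **`rank MT(X) = 5 = dim X + 1` FOR THE SIMPLE COMPLEX TORUS WITH AN ENDOMORPHISM OF CHARACTERISTIC POLYNOMIAL `Φ₁₅`**:
`X ≅ ℂ⁴/Φ(𝔞)` with `Φ` primitive (structure theorem; simple ⟺ primitive), `rank MT = Rank(Φ) = 5` (§1).  The simple ζ₁₅-fourfold is
NONDEGENERATE (no exceptional Hodge classes — Dodson's theorem for simple CM fourfolds with abelian CM field).
[cite: Dodson1984, §3.3.2 Theorem (p. 16)] [cite: Dodson1987, §1.1 (p. 50)] [cite: BirkenhakeLange2004, §13.3] -/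
theorem IsSimple.mtRank_hodgeStructure_eq_five_of_charpoly_eq_cyclotomic_fifteen [HodgeTensorFacts.{0, 0}]
    (hX : ComplexTorus.IsSimple P) {A : Matrix ι ι ℤ} (hA : A ∈ endRingInt P)
    (hP : A.charpoly = cyclotomic 15 ℤ) : (hodgeStructure P 1).mtRank = 5 := by
  have hζ := IsCyclotomicExtension.zeta_spec 15 ℚ (CyclotomicField 15 ℚ)
  obtain ⟨Φ, I, e, he, he₂, -⟩ :=
    exists_cmType_ideal_iso_of_charpoly_eq_cyclotomic hζ hA hP
  obtain ⟨φ₀⟩ : Nonempty (CyclotomicField 15 ℚ →+* ℂ) := inferInstance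
  have hS : ComplexTorus.IsSimple (periodIso Φ I) := (IsIsomorphic.isSimple_iff ⟨e, he, he₂⟩).1 hX
  rw [IsIsomorphic.mtRank_hodgeStructure_eq P (periodIso Φ I) (k := 1) ⟨e, he, he₂⟩,
    mtRank_hodgeStructure_periodIso_eq_cmTypeRank_fifteen Φ I,
    cmTypeRank_eq_five_of_isPrimitive_fifteen (CyclotomicField.isCyclotomicExtension 15 ℚ) Φ φ₀
      ((isSimple_periodIso_iff_isPrimitive Φ I φ₀).1 hS)]

set_option backward.isDefEq.respectTransparency false in -- see above
/-- **`rank MT(X) = 3` OR `2` FOR THE NON-SIMPLE COMPLEX TORI WITH AN ENDOMORPHISM OF CHARACTERISTIC POLYNOMIAL `Φ₁₅`**: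
`= 3` when `X ∼ B²` (`B = ℂ²/Φ₁(𝔞₁)` a simple CM surface of a quartic subfield `K₁ ⊂ ℚ(ζ₁₅)`: the type of `X` is induced
from `ℚ(ζ₅)`, rank `3`), `= 2` when `X ∼ E⁴` (`E` a CM elliptic curve of `ℚ(√−15)` or `ℚ(√−3)`, rank `2`) — `rank MT` is
the rank of the type of the model `ℂ⁴/Φ(𝔞) ≅ X`. [cite: Dodson1987, §1.1 (p. 50)] [cite: Shimura1998, §6.2 Thm. 3, §8.4 Example (2)]
[cite: MoonenZarhin1999LowDim, §1 (1.2)] [cite: BirkenhakeLange2004, §13.3] -/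
theorem mtRank_hodgeStructure_eq_of_not_isSimple_of_charpoly_eq_cyclotomic_fifteen [HodgeTensorFacts.{0, 0}]
    (hns : ¬ ComplexTorus.IsSimple P) {A : Matrix ι ι ℤ} (hA : A ∈ endRingInt P)
    (hP : A.charpoly = cyclotomic 15 ℤ) :
    ((∃ (K₁ : IntermediateField ℚ (CyclotomicField 15 ℚ)) (Φ₁ : CMType K₁), finrank ℚ K₁ = 4 ∧
        ∀ I₁ : (FractionalIdeal (𝓞 K₁)⁰ K₁)ˣ,
          ComplexTorus.IsSimple (periodIso Φ₁ I₁) ∧ IsIsogenous P (powPeriod (periodIso Φ₁ I₁) 2)) ∧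
      (hodgeStructure P 1).mtRank = 3) ∨
    ((∃ (K₁ : IntermediateField ℚ (CyclotomicField 15 ℚ)) (Φ₁ : CMType K₁), finrank ℚ K₁ = 2 ∧
        ∀ I₁ : (FractionalIdeal (𝓞 K₁)⁰ K₁)ˣ,
          ComplexTorus.IsSimple (periodIso Φ₁ I₁) ∧ IsIsogenous P (powPeriod (periodIso Φ₁ I₁) 4)) ∧
      (hodgeStructure P 1).mtRank = 2) := by
  have hζ := IsCyclotomicExtension.zeta_spec 15 ℚ (CyclotomicField 15 ℚ)
  obtain ⟨Φ, I, e, he, he₂, -⟩ :=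
    exists_cmType_ideal_iso_of_charpoly_eq_cyclotomic hζ hA hP
  have hX : IsIsomorphic P (periodIso Φ I) := ⟨e, he, he₂⟩
  obtain ⟨φ₀⟩ : Nonempty (CyclotomicField 15 ℚ →+* ℂ) := inferInstance
  have hnp : ¬ IsPrimitive (ℂ ≃+* ℂ) Φ.1 φ₀ :=
    fun h ↦ hns (hX.isSimple_iff.2 ((isSimple_periodIso_iff_isPrimitive Φ I φ₀).2 h))
  have hmt : (hodgeStructure P 1).mtRank = cmTypeRank Φ := by
    rw [IsIsomorphic.mtRank_hodgeStructure_eq P (periodIso Φ I) (k := 1) hX,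
      mtRank_hodgeStructure_periodIso_eq_cmTypeRank_fifteen Φ I]
  rcases (not_isPrimitive_iff_stable_fifteen Φ φ₀).1 hnp with hB | hC | hD
  · obtain ⟨K₁, Φ₁, h4, -, hI⟩ := exists_isIsogenous_sq_periodIso_of_stable_eleven_fifteen Φ I hB
    exact Or.inl ⟨⟨K₁, Φ₁, h4, fun I₁ ↦ ⟨(hI I₁).1, IsIsogenous.trans _ _ _ hX.isIsogenous (hI I₁).2⟩⟩,
      by rw [hmt, cmTypeRank_eq_three_of_stable_eleven_fifteen Φ hB]⟩
  · obtain ⟨K₁, Φ₁, h2, -, hI⟩ := exists_isIsogenous_pow_four_periodIso_of_stable_fifteen Φ I (Or.inl hC)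
    exact Or.inr ⟨⟨K₁, Φ₁, h2, fun I₁ ↦ ⟨(hI I₁).1, IsIsogenous.trans _ _ _ hX.isIsogenous (hI I₁).2⟩⟩,
      by rw [hmt, cmTypeRank_eq_two_of_stable_two_or_seven_fifteen Φ (Or.inl hC)]⟩
  · obtain ⟨K₁, Φ₁, h2, -, hI⟩ := exists_isIsogenous_pow_four_periodIso_of_stable_fifteen Φ I (Or.inr hD)
    exact Or.inr ⟨⟨K₁, Φ₁, h2, fun I₁ ↦ ⟨(hI I₁).1, IsIsogenous.trans _ _ _ hX.isIsogenous (hI I₁).2⟩⟩,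
      by rw [hmt, cmTypeRank_eq_two_of_stable_two_or_seven_fifteen Φ (Or.inr hD)]⟩

/-- **`rank MT(X) = 5 ⟺ X` SIMPLE**, for a complex torus with an endomorphism of characteristic polynomial `Φ₁₅` (`5` for
the simple one, `3` or `2` otherwise). [cite: Dodson1984, §3.3.2 Theorem (p. 16)] [cite: MoonenZarhin1999LowDim, §1 (1.2)] -/
theorem mtRank_hodgeStructure_eq_five_iff_isSimple_of_charpoly_eq_cyclotomic_fifteen [HodgeTensorFacts.{0, 0}] {A : Matrix ι ι ℤ}
    (hA : A ∈ endRingInt P) (hP : A.charpoly = cyclotomic 15 ℤ) :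
    (hodgeStructure P 1).mtRank = 5 ↔ ComplexTorus.IsSimple P := by
  refine ⟨fun h ↦ ?_, fun hX ↦ hX.mtRank_hodgeStructure_eq_five_of_charpoly_eq_cyclotomic_fifteen hA hP⟩
  by_contra hns
  rcases mtRank_hodgeStructure_eq_of_not_isSimple_of_charpoly_eq_cyclotomic_fifteen hns hA hP with ⟨-, h3⟩ | ⟨-, h2⟩
  · rw [h3] at h; omega
  · rw [h2] at h; omega

set_option backward.isDefEq.respectTransparency false in -- see above
/-- **THE HODGE CLASSES ON EVERY POWER OF EVERY COMPLEX TORUS WITH AN ENDOMORPHISM OF CHARACTERISTIC POLYNOMIAL `Φ₁₅`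
ARE GENERATED BY DIVISOR CLASSES**: `Hdg(Xᵏ) = Div(Xᵏ)` for all `k` (so the Hodge conjecture holds for all powers of the
four ζ₁₅-fourfolds).  Simple `X`: an abelian variety with Mumford–Tate torus and `rank MT = 5 = dim + 1` (§1 and
`IsAbelianVariety.forall_powPeriod_divisorClasses_eq_hodgeClasses_iff_mtRank_eq_card…`).  Non-simple `X`: `X ∼ B²` or
`X ∼ E⁴` with `B`, `E` SIMPLE of dimension `≤ 3`, abelian varieties (a factor of a power isogenous to the abelian variety
`X`), with a Mumford–Tate torus; «`Hdg = Div` on all powers» holds for them (`dim ≤ 3`, simple, of CM type) and is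
transported along `X ∼ Yⁿ`. [cite: MoonenZarhin1999LowDim, Thm. 0.1] [cite: Dodson1984, §3.3.2 Theorem (p. 16)]
[cite: Gordon1999HodgeAVSurvey, §9.3 and 7.6] [cite: BirkenhakeLange2004, §13.3] -/
theorem divisorClasses_powPeriod_eq_hodgeClasses_of_charpoly_eq_cyclotomic_fifteen {A : Matrix ι ι ℤ} (hA : A ∈ endRingInt P)
    (hP : A.charpoly = cyclotomic 15 ℤ) (k p : ℕ) :
    divisorClasses (powPeriod P k) p = hodgeClasses (powPeriod P k) p := by
  haveI : HodgeTensorFacts.{0, 0} := hodgeTensorFacts_holds.{0, 0}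
  have hXav := isAbelianVariety_of_charpoly_eq_cyclotomic hA hP
  by_cases hX : ComplexTorus.IsSimple P
  · have hcard := card_eq_eight₃₆ hP
    haveI : Nonempty ι := Fintype.card_pos_iff.1 (by omega)
    exact (hXav.forall_powPeriod_divisorClasses_eq_hodgeClasses_iff_mtRank_eq_card_of_isSimple_of_isTorusSubgroup_mumfordTateGroupC
      hX (isTorusSubgroup_mumfordTateGroupC_of_charpoly_eq_cyclotomic hA hP)).2
      (by rw [hX.mtRank_hodgeStructure_eq_five_of_charpoly_eq_cyclotomic_fifteen hA hP, hcard]) k p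
  · rcases exists_isIsogenous_pow_of_not_isSimple_of_charpoly_eq_cyclotomic_fifteen hA hP hX with
      ⟨K₁, Φ₁, h4, hI⟩ | ⟨K₁, Φ₁, h2, hI⟩
    · obtain ⟨hS₁, hiso⟩ := hI 1
      have hY : IsAbelianVariety (periodIso Φ₁ 1) :=
        (isAbelianVariety_powPeriod_iff _ two_pos).1 ((IsIsogenous.isAbelianVariety_iff _ _ hiso).1 hXav)
      have hcard : Fintype.card (basisIndex (1 : (FractionalIdeal (𝓞 K₁)⁰ K₁)ˣ)) = 4 := by
        rw [card_basisIndex_eq_finrank, h4]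
      haveI : Nonempty (basisIndex (1 : (FractionalIdeal (𝓞 K₁)⁰ K₁)ˣ)) := Fintype.card_pos_iff.1 (by omega)
      exact (forall_powPeriod_divisorClasses_eq_hodgeClasses_iff_of_isIsogenous_powPeriod hY two_pos hiso).2
        (fun k p ↦ hY.divisorClasses_powPeriod_eq_hodgeClasses_of_isSimple_of_card_le_six_of_isTorusSubgroup_mumfordTateGroupC
          hS₁ (isTorusSubgroup_mumfordTateGroupC_periodIso Φ₁ 1) (by omega) k p) k p
    · obtain ⟨hS₁, hiso⟩ := hI 1
      have hY : IsAbelianVariety (periodIso Φ₁ 1) :=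
        (isAbelianVariety_powPeriod_iff _ four_pos).1 ((IsIsogenous.isAbelianVariety_iff _ _ hiso).1 hXav)
      have hcard : Fintype.card (basisIndex (1 : (FractionalIdeal (𝓞 K₁)⁰ K₁)ˣ)) = 2 := by
        rw [card_basisIndex_eq_finrank, h2]
      haveI : Nonempty (basisIndex (1 : (FractionalIdeal (𝓞 K₁)⁰ K₁)ˣ)) := Fintype.card_pos_iff.1 (by omega)
      exact (forall_powPeriod_divisorClasses_eq_hodgeClasses_iff_of_isIsogenous_powPeriod hY four_pos hiso).2
        (fun k p ↦ hY.divisorClasses_powPeriod_eq_hodgeClasses_of_isSimple_of_card_le_six_of_isTorusSubgroup_mumfordTateGroupC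
          hS₁ (isTorusSubgroup_mumfordTateGroupC_periodIso Φ₁ 1) (by omega) k p) k p

end Fifteen

end ComplexTorus

end Literature.Geometry.Kaehler

end
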